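import Mathlib
import Literature.NumberTheory.LFunctions.Zhang2022.SkeletonPartThree
import HarnessLib

/-!
# Zhang (2022) §13 "Approximation to `Ξ₁₄`", typed statement-exact: (13.1)–(13.3), the
# displayed proof steps between them, the reduction to `𝒦*ⱼ`, and the (2.34)-example behind (13.11)

Topic `Literature/NumberTheory/LFunctions/Zhang2022` (Landau–Siegel audit tree; verdict-neutral).
Y. Zhang, *Discrete mean estimates and the Landau–Siegel zero*, arXiv:2211.02515v1 (2022)
[Zhang2022LandauSiegel], §13, PDF pp. 74–75 (e-print source `lsz3__2_.tex` L3721–L3817) — **an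
unrefereed manuscript under adjudication; every `def … : Prop` below is a CLAIM OF THE MANUSCRIPT,
STATED NOT ASSERTED** (campaign D-0069, statement typing; typed ≠ discharged). Nothing in this file
asserts or denies the manuscript's Theorems 1–2 or says anything about Landau–Siegel zeros.

This file types, one declaration per displayed formula, the part of §13 that the banked skeleton
(`SkeletonPartThree`, §13 block) does not already carry. The skeleton's objects and nodes are
REUSED by name, never restated: `Skeleton.cstar` (`𝒞*(ρ,ψ)`), `Skeleton.Zpc` (`Z(s,ψχ)`),
`Skeleton.Bpoly` (`B(s,ψ)`, (12.2)), `Skeleton.Kchar`/`Skeleton.Nchar` (`K(s,θ)`, `N(w,θ)` of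
Lemma 6.1), `Skeleton.E1full c₀` (`E₁(s,ψ)` of Lemma 6.1 with its `ε = exp{−c₀𝓛¹⁰}`),
`Skeleton.kstar1/2/3` ((13.4)–(13.6)), `Skeleton.E1star` (`E₁*(ρ,ψ)`), `Skeleton.Phi1/2/3`
((13.8)–(13.10)), `Skeleton.frakE` (`𝓔`), `Skeleton.Eq137` ((13.7)), `Skeleton.Eq1311` ((13.11)),
`GammaFactor.Zfac` (`Z(s,ψ)` of (2.2)), `Skeleton.Mfun` (`M(s,ψ) = Y(s,ψ)L(s,ψ)`),
`Lemma81.segInt` (`(1/2πi)∫_{𝒥(z)}`, `𝒥(z) = [s₀+z−i𝓛₁, s₀+z+i𝓛₁]`, §7 p. 33).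

| DAG node (plan/DAG.tsv) | locator | declaration | kind |
|---|---|---|---|
| `Z22:(13.1)` | p.74, (13.1), tex L3733 | `Eq131a`, `Eq131b`, `Eq131` | CLAIM (two printed equalities) |
| `Z22:§13.u001` | p.74, tex L3739 | `U001` | CLAIM ("By Lemma 6.1") |
| `Z22:§13.u002` | p.74, tex L3744 | `U002` | CLAIM ("by Lemma 5.1") |
| `Z22:(13.2)` | p.74, (13.2), tex L3748 | `Eq132` | CLAIM ("Hence") |
| `Z22:§13.u003` | p.74, tex L3755 | `U003` | CLAIM ("By Lemma 6.1 and 5.1") |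
| `Z22:(13.3)` | p.74, (13.3), tex L3760 | `main133` (object), `Eq133` | CLAIM |
| `Z22:§13.u004` | p.74, tex L3769 | `Skeleton.E1star` (`E₁*(ρ,ψ)`) | object, banked p409865 |
| `Z22:§13.u005` | p.75, tex L3775 | `U005` | CLAIM ("Multiplying (13.3) by `Z(ρ,χψ)⁻¹B(ρ,ψ)` and applying Lemma 4.8") |
| `Z22:(13.4)`–`Z22:(13.6)` | p.75, tex L3779–L3787 | `Skeleton.kstar1`, `Skeleton.kstar2`, `Skeleton.kstar3` | objects, banked p409865 |
| `Z22:(13.7)` | p.75, (13.7), tex L3789 | `Skeleton.Eq137` (+ `Skeleton.Eval137`, `Skeleton.eval137_of`) | CLAIM, banked p409865; EDGE `eq137_of_u005` below |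
| `Z22:(13.8)`–`Z22:(13.10)` | p.75, tex L3793–L3801 | `Skeleton.Phi1`, `Skeleton.Phi2`, `Skeleton.Phi3` | objects, banked p409865 |
| `Z22:§13.u006` | p.75, tex L3803 | `Skeleton.frakE` (`𝓔`) | object, banked p409865 |
| `Z22:(13.11)` | p.75, (13.11), tex L3807 | `Skeleton.Eq1311` | CLAIM, banked p409865 |
| `Z22:§13.u007` | p.75, tex L3811 | `exIntegrand` (object), `U007`; shapes `U007a/b/c` (appended) | CLAIM ("For example, by (2.34)"); the closing "estimated via Lemma 5.9, 6.1 and 3.3" is NOT carried out in print — reconstructed shapes, GAP G-L3t6-3 |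

Conventions (as in the skeleton, `skel/INTERFACE.md` §3): every claim is stated inside
`Skeleton.ForAllLarge` ("`D` sufficiently large", `χ (mod D)` real primitive) with Assumption (A)
as an antecedent ("Throughout the rest of this paper we assume that (A) holds", §5 p. 28), for
"`ψ ∈ Ψ₁` and `ρ ∈ 𝔷(ψ)`" (the standing hypothesis of §13, first sentence); "`X = Y + O(E)`" ↦
`∃ C, … ‖X − Y‖ ≤ C·E` with ONE absolute `C` for all the `O`-terms of a display; "`X = Y(1 + O(x))`"
↦ `‖X − Y‖ ≤ C·x·‖Y‖`; `|·|` ↦ `‖·‖`; `(pt₀)^{β}` ↦ `((p·t₀ : ℝ) : ℂ) ^ β` with `p = p_ψ` the modulus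
of `ψ`; `L(·,ψ̄)` ↦ `ψ⁻¹.LFunction` (as in the tree's `GammaFactor.LFunction_eq_Zfac_mul`, (2.2));
`L′(ρ,ψ)` ↦ `deriv ψ.LFunction ρ`. The constant `c′` of (2.13) (`β₁, β₂, β₃`) and the constant `c₀`
of Lemma 6.1's `ε` are parameters, exactly as for `Skeleton.Eq137 c′ c₀`.

Kernel-checked here: `eq137_of_u005` — summing the pointwise claim `U005` over `ψ ∈ Ψ₁, ρ ∈ 𝔷(ψ)`
against `ω(ρ)` ("Inserting this into (12.4) we obtain (13.7)") yields exactly the banked node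
`Skeleton.Eq137` (with `|ω(ρ)|`, as `Skeleton.frakE` is defined); so the leaf `Eq137` of
`Skeleton.theorem1_of_leaves` is refined to the per-zero display of p. 75.

What is deliberately NOT here: no new external fact (FACT-LIST inputs are not needed in §13); no
claim is discharged; the observations of record on the printed error terms (E.g. that `E₁*` carries
the `t₀⁻¹` of the first line of (13.1), and that the display after (13.3) shows no separate
`O(𝓛⁻¹⁰⁰)`-term from Lemma 4.8) are typed AS PRINTED and left to the adjudication.

## References

* Y. Zhang, arXiv:2211.02515v1 (2022), §13 pp. 74–75; §2 (2.2), (2.34); §6 Lemma 6.1; §7 p. 33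
  (`𝒥(z)`); §12 (12.2), (12.4). [cite: Zhang2022LandauSiegel, §13]
-/

noncomputable section

open Complex Real ComplexConjugate

namespace Literature.NumberTheory.LFunctions.Zhang2022.Typed.Section13

open Skeleton

variable (c' c₀ : ℝ)

/-! ## (13.1): `𝒞*(ρ,ψ)` through `L(ρ+β_j,ψ)` (Lemma 5.2 and (2.2)) -/

/-- **(13.1), first line** (Z22 p.74, (13.1), tex L3733–3734): "Assume that `ψ ∈ Ψ₁` and
`ρ ∈ 𝔷(ψ)`. By Lemma 5.2 and (2.2),
`𝒞*(ρ,ψ) = −iZ(ρ+β₃,ψ)⁻¹ L(ρ+β₁,ψ)L(ρ+β₂,ψ)L(ρ+β₃,ψ)/L′(ρ,ψ) · (1 + O(1/t₀))`."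
Typed as `‖𝒞*(ρ,ψ) − T‖ ≤ C·t₀⁻¹·‖T‖`, `T` the displayed main term. CLAIM (a proof step refining the
leaf `Skeleton.Eq137`). [cite: Zhang2022LandauSiegel, §13 (13.1) p.74] -/
def Eq131a : Prop :=
  ∃ C : ℝ, ForAllLarge fun D _ χ => AssumptionA D χ → ∀ x ∈ PsiOne χ, ∀ ρ ∈ zeroSet D x,
    let T : ℂ := -I * (GammaFactor.Zfac x.ψ (ρ + beta3 c' D))⁻¹ *
      (x.ψ.LFunction (ρ + beta1 c' D) * x.ψ.LFunction (ρ + beta2 c' D) *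
        x.ψ.LFunction (ρ + beta3 c' D) / deriv x.ψ.LFunction ρ)
    ‖cstar c' D x ρ - T‖ ≤ C * (t0 D)⁻¹ * ‖T‖

/-- **(13.1), second line** (Z22 p.74, (13.1), tex L3735): for `ψ ∈ Ψ₁`, `ρ ∈ 𝔷(ψ)`,
"`𝒞*(ρ,ψ) = −i L(ρ+β₁,ψ)L(ρ+β₂,ψ)L(1−ρ−β₃,ψ̄)/L′(ρ,ψ) · (1 + O(𝓛⁻¹²³))`."
Typed as `‖𝒞*(ρ,ψ) − T‖ ≤ C·𝓛⁻¹²³·‖T‖`. CLAIM. [cite: Zhang2022LandauSiegel, §13 (13.1) p.74] -/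
def Eq131b : Prop :=
  ∃ C : ℝ, ForAllLarge fun D _ χ => AssumptionA D χ → ∀ x ∈ PsiOne χ, ∀ ρ ∈ zeroSet D x,
    let T : ℂ := -I * (x.ψ.LFunction (ρ + beta1 c' D) * x.ψ.LFunction (ρ + beta2 c' D) *
      x.ψ⁻¹.LFunction (1 - ρ - beta3 c' D) / deriv x.ψ.LFunction ρ)
    ‖cstar c' D x ρ - T‖ ≤ C * (ell D ^ 123)⁻¹ * ‖T‖

/-- **(13.1)** (Z22 p.74, (13.1), tex L3733–3737): both printed equalities. CLAIM.
[cite: Zhang2022LandauSiegel, §13 (13.1) p.74] -/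
def Eq131 : Prop := Eq131a c' ∧ Eq131b c'

/-! ## The steps from (13.1) to (13.3) -/

/-- **§13, display after (13.1)** (Z22 p.74, tex L3739–3742): "By Lemma 6.1,
`L(1−ρ−β₃,ψ̄) = \overline{L(ρ+β₃,ψ)} = K(1−ρ−β₃,ψ̄) + Z(ρ+β₃,ψ)⁻¹N(ρ+β₃,ψ) + O(E₁(ρ+β₃,ψ))`,"
for `ψ ∈ Ψ₁`, `ρ ∈ 𝔷(ψ)` — the first equality exact (`1 − ρ − β₃ = \overline{ρ + β₃}` on the
critical line, `β₃` imaginary), the second with `E₁ = Skeleton.E1full c₀` (Lemma 6.1's error,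
`ε = exp{−c₀𝓛¹⁰}` included). CLAIM. [cite: Zhang2022LandauSiegel, §13 p.74 (display after (13.1))] -/
def U001 : Prop :=
  ∃ C : ℝ, ForAllLarge fun D _ χ => AssumptionA D χ → ∀ x ∈ PsiOne χ, ∀ ρ ∈ zeroSet D x,
    x.ψ⁻¹.LFunction (1 - ρ - beta3 c' D) = conj (x.ψ.LFunction (ρ + beta3 c' D)) ∧
      ‖x.ψ⁻¹.LFunction (1 - ρ - beta3 c' D) - Kchar D (psiBarFn x) (1 - ρ - beta3 c' D) -
          (GammaFactor.Zfac x.ψ (ρ + beta3 c' D))⁻¹ * Nchar D (psiFn x) (ρ + beta3 c' D)‖ ≤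
        C * E1full c₀ x (ρ + beta3 c' D)

/-- **§13, second display after (13.1)** (Z22 p.74, tex L3744–3746): "and, by Lemma 5.1,
`Z(ρ+β₃,ψ)⁻¹ = Z(ρ+β₂,ψ)⁻¹(pt₀)^{β₁} + O(𝓛⁻¹²³)`" (`ψ ∈ Ψ₁`, `ρ ∈ 𝔷(ψ)`, `p = p_ψ`; note
`β₃ − β₂ = β₁`). CLAIM. [cite: Zhang2022LandauSiegel, §13 p.74 (second display after (13.1))] -/
def U002 : Prop :=
  ∃ C : ℝ, ForAllLarge fun D _ χ => AssumptionA D χ → ∀ x ∈ PsiOne χ, ∀ ρ ∈ zeroSet D x,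
    ‖(GammaFactor.Zfac x.ψ (ρ + beta3 c' D))⁻¹ -
        (GammaFactor.Zfac x.ψ (ρ + beta2 c' D))⁻¹ * (((x.p : ℝ) * t0 D : ℝ) : ℂ) ^ beta1 c' D‖ ≤
      C * (ell D ^ 123)⁻¹

/-- **(13.2)** (Z22 p.74, (13.2), tex L3748–3752): "Hence
`L(ρ+β₂,ψ)L(1−ρ−β₃,ψ̄) = L(ρ+β₂,ψ)K(1−ρ−β₃,ψ̄) + (pt₀)^{β₁}N(ρ+β₃,ψ)L(1−ρ−β₂,ψ̄)`
`+ O(|L(ρ+β₂,ψ)N(ρ+β₃,ψ)|𝓛⁻¹²³) + O(|L(ρ+β₂,ψ)|E₁(ρ+β₃,ψ))`" (`ψ ∈ Ψ₁`, `ρ ∈ 𝔷(ψ)`; one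
absolute constant for both `O`-terms; `E₁ = Skeleton.E1full c₀`). CLAIM.
[cite: Zhang2022LandauSiegel, §13 (13.2) p.74] -/
def Eq132 : Prop :=
  ∃ C : ℝ, ForAllLarge fun D _ χ => AssumptionA D χ → ∀ x ∈ PsiOne χ, ∀ ρ ∈ zeroSet D x,
    ‖x.ψ.LFunction (ρ + beta2 c' D) * x.ψ⁻¹.LFunction (1 - ρ - beta3 c' D) -
        (x.ψ.LFunction (ρ + beta2 c' D) * Kchar D (psiBarFn x) (1 - ρ - beta3 c' D) +
          (((x.p : ℝ) * t0 D : ℝ) : ℂ) ^ beta1 c' D * Nchar D (psiFn x) (ρ + beta3 c' D) *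
            x.ψ⁻¹.LFunction (1 - ρ - beta2 c' D))‖ ≤
      C * (‖x.ψ.LFunction (ρ + beta2 c' D) * Nchar D (psiFn x) (ρ + beta3 c' D)‖ *
          (ell D ^ 123)⁻¹ +
        ‖x.ψ.LFunction (ρ + beta2 c' D)‖ * E1full c₀ x (ρ + beta3 c' D))

/-- **§13, display after (13.2)** (Z22 p.74, tex L3755–3758): "By Lemma 6.1 and 5.1,
`(pt₀)^{β₁}L(1−ρ−β₂,ψ̄) = (pt₀)^{β₁}K(1−ρ−β₂,ψ̄) + (pt₀)^{β₃}Z(ρ,ψ)⁻¹N(ρ+β₂,ψ)`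
`+ O(N(ρ+β₂,ψ)𝓛⁻¹²³) + O(E₁(ρ+β₂,ψ))`" (`ψ ∈ Ψ₁`, `ρ ∈ 𝔷(ψ)`; `O(N(ρ+β₂,ψ)𝓛⁻¹²³)` read as
`O(|N(ρ+β₂,ψ)|𝓛⁻¹²³)`; note `β₁ + β₂ = β₃`). CLAIM.
[cite: Zhang2022LandauSiegel, §13 p.74 (display after (13.2))] -/
def U003 : Prop :=
  ∃ C : ℝ, ForAllLarge fun D _ χ => AssumptionA D χ → ∀ x ∈ PsiOne χ, ∀ ρ ∈ zeroSet D x,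
    ‖(((x.p : ℝ) * t0 D : ℝ) : ℂ) ^ beta1 c' D * x.ψ⁻¹.LFunction (1 - ρ - beta2 c' D) -
        ((((x.p : ℝ) * t0 D : ℝ) : ℂ) ^ beta1 c' D * Kchar D (psiBarFn x) (1 - ρ - beta2 c' D) +
          (((x.p : ℝ) * t0 D : ℝ) : ℂ) ^ beta3 c' D * (GammaFactor.Zfac x.ψ ρ)⁻¹ *
            Nchar D (psiFn x) (ρ + beta2 c' D))‖ ≤
      C * (‖Nchar D (psiFn x) (ρ + beta2 c' D)‖ * (ell D ^ 123)⁻¹ + E1full c₀ x (ρ + beta2 c' D))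

/-! ## (13.3) and its error `E₁*(ρ,ψ)` -/

/-- **The main term of (13.3)** (Z22 p.74, (13.3), tex L3760–3764):
`−i L(ρ+β₁,ψ)L(ρ+β₂,ψ)/L′(ρ,ψ) · K(1−ρ−β₃,ψ̄)`
`− i(pt₀)^{β₁} L(ρ+β₁,ψ)/L′(ρ,ψ) · N(ρ+β₃,ψ)K(1−ρ−β₂,ψ̄)`
`− i(pt₀)^{β₃}Z(ρ,ψ)⁻¹ L(ρ+β₁,ψ)/L′(ρ,ψ) · N(ρ+β₂,ψ)N(ρ+β₃,ψ)`.
[cite: Zhang2022LandauSiegel, §13 (13.3) p.74] -/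
def main133 {D : ℕ} (x : Chr D) (ρ : ℂ) : ℂ :=
  -I * (x.ψ.LFunction (ρ + beta1 c' D) * x.ψ.LFunction (ρ + beta2 c' D) /
        deriv x.ψ.LFunction ρ) * Kchar D (psiBarFn x) (1 - ρ - beta3 c' D) -
    I * (((x.p : ℝ) * t0 D : ℝ) : ℂ) ^ beta1 c' D *
        (x.ψ.LFunction (ρ + beta1 c' D) / deriv x.ψ.LFunction ρ) *
        Nchar D (psiFn x) (ρ + beta3 c' D) * Kchar D (psiBarFn x) (1 - ρ - beta2 c' D) -
    I * (((x.p : ℝ) * t0 D : ℝ) : ℂ) ^ beta3 c' D * (GammaFactor.Zfac x.ψ ρ)⁻¹ *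
        (x.ψ.LFunction (ρ + beta1 c' D) / deriv x.ψ.LFunction ρ) *
        Nchar D (psiFn x) (ρ + beta2 c' D) * Nchar D (psiFn x) (ρ + beta3 c' D)

/-- **(13.3)** (Z22 p.74, (13.3), tex L3759–3773): "We insert this into (13.2) and then insert the
result into (13.1). Thus we obtain `𝒞*(ρ,ψ) = [main133] + O(E₁*(ρ,ψ))` where
`E₁*(ρ,ψ) = |L(ρ+β₁,ψ)L(ρ+β₂,ψ)/L′(ρ,ψ)|(|L(ρ+β₃,ψ)|t₀⁻¹ + |N(ρ+β₃,ψ)|𝓛⁻¹²³ + E₁(ρ+β₃,ψ))`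
`+ |L(ρ+β₁,ψ)N(ρ+β₃,ψ)/L′(ρ,ψ)|(|N(ρ+β₂,ψ)|𝓛⁻¹²³ + E₁(ρ+β₂,ψ))`" (`E₁*` is the banked object
`Skeleton.E1star c′ c₀`; `ψ ∈ Ψ₁`, `ρ ∈ 𝔷(ψ)`). CLAIM. [cite: Zhang2022LandauSiegel, §13 (13.3) p.74] -/
def Eq133 : Prop :=
  ∃ C : ℝ, ForAllLarge fun D _ χ => AssumptionA D χ → ∀ x ∈ PsiOne χ, ∀ ρ ∈ zeroSet D x,
    ‖cstar c' D x ρ - main133 c' x ρ‖ ≤ C * E1star c' c₀ x ρ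

/-! ## The reduction to `𝒦*ⱼ(ρ,ψ)` (Lemma 4.8) -/

/-- **§13, display after (13.3)** (Z22 p.75, tex L3774–3777): "Recall that `B(s,ψ)` is given by
(12.2). Multiplying (13.3) by `Z(ρ,χψ)⁻¹B(ρ,ψ)` and applying Lemma 4.8 we obtain
`𝒞*(ρ,ψ)Z(ρ,χψ)⁻¹B(ρ,ψ) = −i(𝒦*₁(ρ,ψ) + (pt₀)^{β₁}𝒦*₂(ρ,ψ) − (pt₀)^{β₃}𝒦*₃(ρ,ψ)) + O(E₁*(ρ,ψ)|B(ρ,ψ)|)`"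
with `𝒦*ⱼ` as in (13.4)–(13.6) (the banked `Skeleton.kstar1/2/3`), for `ψ ∈ Ψ₁`, `ρ ∈ 𝔷(ψ)`. The
error term is typed AS PRINTED (no separate `O(𝓛⁻¹⁰⁰)`-term from Lemma 4.8 is displayed). CLAIM.
[cite: Zhang2022LandauSiegel, §13 p.75 (display after (13.3))] -/
def U005 : Prop :=
  ∃ C : ℝ, ForAllLarge fun D _ χ => AssumptionA D χ → ∀ x ∈ PsiOne χ, ∀ ρ ∈ zeroSet D x,
    ‖cstar c' D x ρ * (Zpc χ x ρ)⁻¹ * Bpoly χ x ρ +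
        I * (kstar1 c' χ x ρ + (((x.p : ℝ) * t0 D : ℝ) : ℂ) ^ beta1 c' D * kstar2 c' χ x ρ -
          (((x.p : ℝ) * t0 D : ℝ) : ℂ) ^ beta3 c' D * kstar3 c' χ x ρ)‖ ≤
      C * E1star c' c₀ x ρ * ‖Bpoly χ x ρ‖

/-! ## The example behind (13.11): one term of `𝓔` via (2.34) -/

/-- **The integrand of the example display** (Z22 p.75, tex L3813–3814):
`M(s+β₁,ψ)/M(s,ψ) · L(s+β₂,ψ)L(1−s−β₂,ψ̄) · ω(s)` (`M = Skeleton.Mfun`, `ω = Skeleton.omegaW`).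
[cite: Zhang2022LandauSiegel, §13 p.75 (last display)] -/
def exIntegrand {D : ℕ} (x : Chr D) (s : ℂ) : ℂ :=
  Mfun x.ψ (s + beta1 c' D) / Mfun x.ψ s *
    (x.ψ.LFunction (s + beta2 c' D) * x.ψ⁻¹.LFunction (1 - s - beta2 c' D)) * omegaW D s

/-- **§13, last display** (Z22 p.75, tex L3810–3817): "For example, by (2.34),
`Σ_{ψ∈Ψ₁} Σ_{ρ∈𝔷(ψ)} |L(ρ+β₁,ψ)/L′(ρ,ψ)| |L(ρ+β₂,ψ)|² ω(ρ)`
`= −(1/2π) Σ_{ψ∈Ψ₁} (∫_{𝒥(α)} − ∫_{𝒥(−α)}) M(s+β₁,ψ)/M(s,ψ) · L(s+β₂,ψ)L(1−s−β₂,ψ̄) ω(s) ds + O(ε)`,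
the right side being estimated via Lemma 5.9, 6.1 and 3.3" — `ε = exp{−c𝓛¹⁰}` (§4 p. 19), `𝒥(z)`
the segment `[s₀+z−i𝓛₁, s₀+z+i𝓛₁]` (§7 p. 33). With the tree's `Lemma81.segInt t₀ 𝓛₁ z F =
(1/2πi)∫_{𝒥(z)} F(s) ds` one has `−(1/2π)∫_{𝒥(z)} F ds = −i·segInt z F`, which is how the right side
is written below. CLAIM. [cite: Zhang2022LandauSiegel, §13 p.75 (last display)] -/
def U007 : Prop :=
  ∃ c : ℝ, 0 < c ∧ ∃ C : ℝ, ForAllLarge fun D _ χ => AssumptionA D χ →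
    ‖(∑ i ∈ idx χ,
        ((‖i.1.ψ.LFunction (i.2 + beta1 c' D) / deriv i.1.ψ.LFunction i.2‖ *
            ‖i.1.ψ.LFunction (i.2 + beta2 c' D)‖ ^ 2 : ℝ) : ℂ) * omegaW D i.2) -
        (-I * ∑ x ∈ finsetOf (PsiOne χ),
          (Lemma81.segInt (t0 D) (ell1 D) ((alpha D : ℝ) : ℂ) (exIntegrand c' x) -
            Lemma81.segInt (t0 D) (ell1 D) ((-alpha D : ℝ) : ℂ) (exIntegrand c' x)))‖ ≤
      C * Real.exp (-c * ell D ^ 10)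

/-! ## Kernel-checked edge: the pointwise display after (13.3) summed against `ω(ρ)` is (13.7) -/

/-- **"Inserting this into (12.4) we obtain (13.7)"** (Z22 p.75, tex L3788–3805), kernel-checked:
the pointwise claim `U005` (for every `ψ ∈ Ψ₁`, `ρ ∈ 𝔷(ψ)`) implies the banked node
`Skeleton.Eq137 c′ c₀`, i.e. `Ξ₁₄ = −i(Φ₁ + Φ₂ − Φ₃) + O(𝓔)` with
`𝓔 = ΣΣ E₁*(ρ,ψ)|B(ρ,ψ)||ω(ρ)|` — by `Ξ₁₄ = ΣΣ 𝒞*Z(ρ,ψχ)⁻¹B ω` (12.4), (13.8)–(13.10) and the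
triangle inequality, with the same constant. [cite: Zhang2022LandauSiegel, §13 (13.7) p.75] -/
theorem eq137_of_u005 (h : U005 c' c₀) : Skeleton.Eq137 c' c₀ := by
  obtain ⟨C, D₀, hC⟩ := h
  refine ⟨C, D₀, fun D _ χ hD hq hp hA => ?_⟩
  have hpt := hC D χ hD hq hp hA
  have key : xi14 c' χ + I * (Phi1 c' χ + Phi2 c' χ - Phi3 c' χ) =
      ∑ i ∈ idx χ, (cstar c' D i.1 i.2 * (Zpc χ i.1 i.2)⁻¹ * Bpoly χ i.1 i.2 +
        I * (kstar1 c' χ i.1 i.2 +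
          (((i.1.p : ℝ) * t0 D : ℝ) : ℂ) ^ beta1 c' D * kstar2 c' χ i.1 i.2 -
          (((i.1.p : ℝ) * t0 D : ℝ) : ℂ) ^ beta3 c' D * kstar3 c' χ i.1 i.2)) * omegaW D i.2 := by
    rw [xi14, Phi1, Phi2, Phi3, ← Finset.sum_add_distrib, ← Finset.sum_sub_distrib, Finset.mul_sum,
      ← Finset.sum_add_distrib]
    refine Finset.sum_congr rfl fun i _ => ?_
    ring
  rw [key, frakE, Finset.mul_sum]
  refine le_trans (norm_sum_le _ _) (Finset.sum_le_sum fun i hi => ?_)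
  have hx : i.1 ∈ PsiOne χ := mem_of_mem_finsetOf (Finset.mem_sigma.mp hi).1
  have hρ : i.2 ∈ zeroSet D i.1 := mem_of_mem_finsetOf (Finset.mem_sigma.mp hi).2
  have hb := hpt i.1 hx i.2 hρ
  rw [norm_mul]
  calc _ ≤ C * E1star c' c₀ i.1 i.2 * ‖Bpoly χ i.1 i.2‖ * ‖omegaW D i.2‖ := by
        gcongr
    _ = C * (E1star c' c₀ i.1 i.2 * ‖Bpoly χ i.1 i.2‖ * ‖omegaW D i.2‖) := by ring

/-! ### "the right side being estimated via Lemma 5.9, 6.1 and 3.3" — NOT carried out in print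

The three declarations below are NOT displayed in the manuscript: they are the SHAPES the named
estimates would have to take for the example term of (13.11), written by analogy with the printed
parallel estimates of §8 (Z22 p.44, tex L2244–2250: "By Cauchy's inequality, Lemma 6.1, and the second
assertion of Lemma 3.3, for `s ∈ 𝒥(α)`, `Σ_{ψ∈Ψ₁}|L(s+β₂,ψ)L(s+β₃,ψ)|² ≪ P²𝓛³⁶` … These estimates
together with (7.4) and (2.9) imply … `= o(𝔓)`"). Exponents of `𝓛` that the manuscript does not
print are existentially quantified (`∃ k`). They are recorded so that the gap "(13.11) is not verified
in print" (plan/GAP-LEDGER.md G-L3t6-3) has exact typed targets; typed ≠ asserted. -/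

/-- `Z22:§13.u007` RECONSTRUCTED SHAPE (not printed; "estimated via Lemma 5.9", Z22 p.75 tex L3817):
on the segments `𝒥(±α)` (`s = ±α + s₀ + iv`, `|v| ≤ 𝓛₁`), for `ψ ∈ Ψ₁`,
`M(s+β₁,ψ)/M(s,ψ) ≪ log P` — the role Lemma 5.9 (`L(s+β₁,ψ)/L(s,ψ) ≪ log P` at distance `≫ α` from
the zeros) plays for the integrand `exIntegrand`. CLAIM-shape for GAP G-L3t6-3, constants not in
print. [cite: Zhang2022LandauSiegel, §13 p. 75, last sentence] -/
def U007a : Prop :=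
  ∃ C : ℝ, ForAllLarge fun D _ χ => AssumptionA D χ → ∀ x ∈ PsiOne χ, ∀ σ : ℝ,
    (σ = alpha D ∨ σ = -alpha D) → ∀ v : ℝ, |v| ≤ ell1 D →
      ‖Mfun x.ψ ((σ : ℂ) + s0 D + v * I + beta1 c' D) / Mfun x.ψ ((σ : ℂ) + s0 D + v * I)‖ ≤
        C * Real.log (bigP D)

/-- `Z22:§13.u007` RECONSTRUCTED SHAPE (not printed; "estimated via Lemma … 6.1 and 3.3", Z22 p.75
tex L3817; printed parallel: §8 p.44 tex L2244–2247 `Σ_{ψ∈Ψ₁}|L(s+β₂,ψ)L(s+β₃,ψ)|² ≪ P²𝓛³⁶`): on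
`𝒥(±α)`, `Σ_{ψ∈Ψ₁} |L(s+β₂,ψ)L(1−s−β₂,ψ̄)| ≪ P²𝓛ᵏ` for some absolute `k` (NOT specified in print).
CLAIM-shape for GAP G-L3t6-3. [cite: Zhang2022LandauSiegel, §13 p. 75, last sentence] -/
def U007b : Prop :=
  ∃ k : ℕ, ∃ C : ℝ, ForAllLarge fun D _ χ => AssumptionA D χ → ∀ σ : ℝ,
    (σ = alpha D ∨ σ = -alpha D) → ∀ v : ℝ, |v| ≤ ell1 D →
      ∑ x ∈ finsetOf (PsiOne χ),
          ‖x.ψ.LFunction ((σ : ℂ) + s0 D + v * I + beta2 c' D) *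
            x.ψ⁻¹.LFunction (1 - ((σ : ℂ) + s0 D + v * I) - beta2 c' D)‖ ≤
        C * bigP D ^ 2 * ell D ^ k

/-- `Z22:§13.u007` RECONSTRUCTED SHAPE (not printed): the conclusion the example is meant to deliver
towards (13.11), `Σ_{ψ∈Ψ₁}Σ_{ρ∈𝔷(ψ)} |L(ρ+β₁,ψ)/L′(ρ,ψ)| |L(ρ+β₂,ψ)|² |ω(ρ)| ≪ 𝔓𝓛ᵏ` for some
absolute `k` (NOT specified in print; "(7.4) and (2.9)" convert `P²𝓛ᶜ∫|ω(s)ds|` into `𝔓𝓛ᵏ` in the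
§8 parallel, tex L2249–2250). With Cauchy's inequality this bounds the `t₀⁻¹`-term of `𝓔` by
`t₀⁻¹(𝔓𝓛ᵏ)^{1/2}(…)^{1/2}`. CLAIM-shape for GAP G-L3t6-3. [cite: Zhang2022LandauSiegel, §13 p. 75, last sentence] -/
def U007c : Prop :=
  ∃ k : ℕ, ∃ C : ℝ, ForAllLarge fun D _ χ => AssumptionA D χ →
    ∑ i ∈ idx χ, ‖i.1.ψ.LFunction (i.2 + beta1 c' D) / deriv i.1.ψ.LFunction i.2‖ *
        ‖i.1.ψ.LFunction (i.2 + beta2 c' D)‖ ^ 2 * ‖omegaW D i.2‖ ≤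
      C * frakP D * ell D ^ k

end Literature.NumberTheory.LFunctions.Zhang2022.Typed.Section13
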